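import Summits.BirchSwinnertonDyer.Rank1Residual.X11b.Three.GoodReductionSubgroupCuspPadic
import Summits.BirchSwinnertonDyer.Rank1Residual.X11b.Three.JetchevKummerLinkGlobal
import HarnessLib

/-!
# X11b at `p = 3` (team N8/O2), JET3-KUMMER: Jetchev's Prop. 4.1 at EVERY bad place in the
# restricted-global Kummer currency — ONE call, multiplicative or additive (S15 capstone, C2)

HONEST FRAMING (cell `b2b-bsdres`, run/shared/lean/b2b/bsd-rank1-residual/, verbatim in every
file): the goal of the cell is to DELETE the COMBINATION-SHAPED residual classes of the
Birch–Swinnerton-Dyer formula for ALL analytic-rank `≤ 1` elliptic curves over `ℚ` — "full BSD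
formula for every rank `≤ 1` curve in class `C`" assembled STRICTLY from published theorems — so
that the rank-`≤ 1` remainder becomes exactly the CONSTRUCTION-SHAPED classes, which are TYPED
(missing-input `Prop`s), NOT attempted. This is not "finishing BSD". Team N8/O2 = `x11b3`, seat
`b2b-bsdres-x11b3-p4` (provider of record at additive places; `S15-INTERFACE.md`). THEOREMS ONLY:
no definition, no named fact, no `sorry`; nothing is booked; the flag `JET@p|N` is NOT discharged
(Jetchev 2008 §3, §§5–7 and the structure theorem remain).

## What

x11b3-p1's `localKummerMap_mem_connectedKummerCondition_of_cocycle_baseChange`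
(`JetchevKummerLinkGlobal`, p253808) is Jetchev 2008 Prop. 4.1 at a bad place `v` of a GLOBAL
curve `W/K₀` in the restricted-global currency — `δ_v(t) ∈ H¹_{Kum⁰}(K_v, E[p^m])` — modulo the
named inputs `hstab`, (α), (b) and the cocycle. x11b3-p2's leaves discharge `hstab`/(α) per
reduction type (`MultiplicativePlaceAlpha` p257338, `AdditivePlaceKummer` p258461). With part 15
(`hα_of_not_hasGoodReduction_of_adicComplete`: (α) at EVERY bad place of the layer, Mathlib's
trichotomy) the case split disappears:

* §0 `hasGoodReduction_of_hasGoodReduction_baseChange` /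
  `not_hasGoodReduction_baseChange_of_not_hasGoodReduction` — good reduction descends along a
  local `R₀ → R` (a local homomorphism reflects units), i.e. bad reduction ascends to the layer;
* §1 **`localKummerMap_mem_connectedKummerCondition_of_cocycle_of_not_hasGoodReduction`** — Prop. 4.1
  at ANY BAD place `v` of `W/K₀` (`hbad : ¬ ((W ⊗ F) ⊗ L).HasGoodReduction R`), Kummer currency,
  modulo input (b) (`hP`/`hR'`) and the cocycle rooted at `t ∈ (W ⊗ F)(F)` ONLY; layer binders =
  `S15-INTERFACE.md` §4 R1–R6, R8 and `[((W ⊗ F) ⊗ L).IsMinimal R]` (a THEOREM by part 19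
  `isMinimal_baseChange_of_frobenius` from the same R1–R6 — kept in the signature because it types
  `E₀(L)`); `…_of_not_hasGoodReduction_base` — the same with the badness read on `E / K_v`
  (`hbad₀ : ¬ ((W ⊗ F) ⊗ F).HasGoodReduction R₀`, §0).
* §2 **`localKummerMap_mem_connectedKummerCondition_padic_of_cocycle_of_not_hasGoodReductionAtPrime`**
  — the same for `E/ℚ` at ANY bad prime `p` (`hg : ¬ W.HasGoodReductionAtPrime p`, split /
  non-split multiplicative or additive alike), via part 15
  `hα_padic_of_not_hasGoodReductionAtPrime_of_adicComplete`; the layer minimality binder is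
  dischargeable by `haveI := isMinimal_baseChange_padic_of_frobenius W p L R hR φ hφ hφn hcard
  hfrob hϖ hπ` (part 19) — or `…_of_five_le` (part 16) at `p ≥ 5`.

These are the (C2)-currency single entry points per bad place / prime for the (iv) consumers
(point currency: part 15 `exists_baseChange_eq_add_pow_smul_padic_of_not_hasGoodReductionAtPrime`;
(C1) currency: p2's `…_of_GZ31_allPlaces`, p259344).

References (locators only; no new fact): [cite: Jetchev2008, Prop. 4.1 (pp. 819–821), Lemma 3.2]
[cite: GrossLMS1991, Prop. 6.2 (1), pp. 244–245] [cite: MilneADT2006, Ch. I Prop. 3.8].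

## Design

No definitions; `noncomputable section`; `open scoped Classical`; universe `u` for `K₀`, `F`, `L`
(§1), `L : Type` in §2. Axioms: `propext`, `Classical.choice`, `Quot.sound`.
-/

noncomputable section

open scoped Classical

namespace Summit.BirchSwinnertonDyer.Rank1Residual.X11b.Three.JetchevKummer

open WeierstrassCurve Literature.NumberTheory.EllipticCurves

universe u

/-! ### §0 Good reduction descends along a local extension of valuation rings -/

section Descent

variable {F : Type u} [Field F] (X : WeierstrassCurve F) (L : Type u) [Field L] [Algebra F L]
  (R₀ : Type*) [CommRing R₀] [IsDomain R₀] [IsDiscreteValuationRing R₀] [Algebra R₀ F]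
  [IsFractionRing R₀ F]
  (R : Type*) [CommRing R] [IsDomain R] [IsDiscreteValuationRing R] [Algebra R L]
  [IsFractionRing R L]
  [Algebra R₀ R] [Algebra R₀ L] [IsScalarTower R₀ R L] [IsScalarTower R₀ F L]
  [IsLocalHom (algebraMap R₀ R)]

/-- **Good reduction descends**: with `R₀ → R` local, if the (`R`-minimal) layer equation
`X ⊗ L` has good reduction then so does the (`R₀`-minimal) base equation `X ⊗ F` — `Δ` is a unit
of `R` iff it is a unit of `R₀` (a local homomorphism reflects units). Contrapositive
`not_hasGoodReduction_baseChange_of_not_hasGoodReduction`: BAD reduction ASCENDS to every layer,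
which turns the layer hypothesis `hbad` of §1 into a statement about `E` over `K_v`.
[cite: SilvermanAEC2009, Prop. VII.5.4 (a) (PDF p. 175)] -/
theorem hasGoodReduction_of_hasGoodReduction_baseChange [(X.baseChange F).IsMinimal R₀]
    [(X.baseChange L).IsMinimal R] (h : (X.baseChange L).HasGoodReduction R) :
    (X.baseChange F).HasGoodReduction R₀ := by
  refine { toIsMinimal := ‹_›, goodReduction := ?_ }
  have hΔ := h.goodReduction
  rw [baseChange_Δ_eq X L R₀ R, valuation_algebraMap_eq_one_iff_isUnit,
    isUnit_map_iff (algebraMap R₀ R)] at hΔ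
  rw [← integralModel_Δ_eq R₀ (X.baseChange F), valuation_algebraMap_eq_one_iff_isUnit]
  exact hΔ

/-- **Bad reduction ascends to every layer**: `¬ (X ⊗ F).HasGoodReduction R₀ →
¬ (X ⊗ L).HasGoodReduction R` (`R₀ → R` local). [cite: SilvermanAEC2009, Prop. VII.5.4 (a)] -/
theorem not_hasGoodReduction_baseChange_of_not_hasGoodReduction [(X.baseChange F).IsMinimal R₀]
    [(X.baseChange L).IsMinimal R] (hbad₀ : ¬ (X.baseChange F).HasGoodReduction R₀) :
    ¬ (X.baseChange L).HasGoodReduction R :=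
  fun h ↦ hbad₀ (hasGoodReduction_of_hasGoodReduction_baseChange X L R₀ R h)

end Descent

/-! ### §1 A global curve at any bad place of the layer -/

section Global

variable {K₀ : Type u} [Field K₀] [CharZero K₀] (W : WeierstrassCurve K₀) [W.IsElliptic]
  (F : Type u) [Field F] [Algebra K₀ F] [CharZero F]
  (L : Type u) [Field L] [Algebra F L]
  (R₀ : Type*) [CommRing R₀] [IsDomain R₀] [IsDiscreteValuationRing R₀] [Algebra R₀ F]
  [IsFractionRing R₀ F]
  (R : Type*) [CommRing R] [IsDomain R] [IsDiscreteValuationRing R] [Algebra R L]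
  [IsFractionRing R L]
  [Algebra R₀ R] [Algebra R₀ L] [IsScalarTower R₀ R L] [IsScalarTower R₀ F L]
  [IsAdicComplete (IsLocalRing.maximalIdeal R) R] [Finite (IsLocalRing.ResidueField R)]
  (W₀ : WeierstrassCurve R)

/-- **Jetchev 2008, Prop. 4.1 at ANY BAD place, restricted-global Kummer currency, ONE call.**
`W` over a global field `K₀`, `F = K_v`, complete Galois layer `L ⊇ F` with valuation rings
`R₀ → R` (local), finite residue field of `qⁿ` elements, `Aut(L/F) = ⟨φ⟩`, `φⁿ = 1`, `φ` lifting
`x ↦ x^q`, every `τ` preserving `R`, a uniformiser of `R` from `F`, and BAD reduction of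
`(W ⊗ F) ⊗ L` over `R` (multiplicative of either sign, or additive). Then, modulo input (b)
(`hP`, `hR'`: `n′ • P`, `n′ • R_σ ∈ E₀(L)`) and the cocycle rooted at `t` (`hU`, `hpU`):
`δ_v(t) ∈ H¹_{Kum⁰}(K_v, E[p^m])`. `hstab` = p4 part 2, (α) = part 15
`hα_of_not_hasGoodReduction_of_adicComplete` (p3's multiplicative glue p256790 ∨ p4's additive
part 14). `JET@p|N` NOT discharged. [cite: Jetchev2008, Prop. 4.1 (pp. 819–821)]
[cite: MilneADT2006, Ch. I Prop. 3.8] -/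
theorem localKummerMap_mem_connectedKummerCondition_of_cocycle_of_not_hasGoodReduction
    [IsGalois F L] [IsLocalHom (algebraMap R₀ R)] [(W.baseChange F).IsMinimal R₀]
    [((W.baseChange F).baseChange L).IsMinimal R]
    (hbad : ¬ ((W.baseChange F).baseChange L).HasGoodReduction R)
    (hX : (W.baseChange F).baseChange L = W₀.baseChange L)
    (hR : ∀ (τ : L ≃ₐ[F] L) (x : L), x ∈ Set.range (algebraMap R L) →
      τ x ∈ Set.range (algebraMap R L))
    (φ : L ≃ₐ[F] L) (hφ : ∀ σ : L ≃ₐ[F] L, σ ∈ Subgroup.zpowers φ) {q n : ℕ} (hφn : φ ^ n = 1)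
    (hcard : Nat.card (IsLocalRing.ResidueField R) = q ^ n)
    (hfrob : ∀ a : R, ∃ a' : R, algebraMap R L a' = φ (algebraMap R L a) ∧
      IsLocalRing.residue R a' = IsLocalRing.residue R a ^ q)
    {ϖ : R} (hϖ : Irreducible ϖ) {π : F} (hπ : algebraMap F L π = algebraMap R L ϖ)
    {p m n' : ℕ} (hcop : Nat.Coprime n' (p ^ m)) (hn : ((p ^ m : ℕ) : ℤ) ≠ 0)
    {t : (W.baseChange F).toAffine.Point} {U P : ((W.baseChange F).baseChange L).toAffine.Point}
    {Rσ : (L ≃ₐ[F] L) → ((W.baseChange F).baseChange L).toAffine.Point}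
    (hP : (n' : ℤ) • P ∈ ((W.baseChange F).baseChange L).goodReductionSubgroup R)
    (hR' : ∀ σ : L ≃ₐ[F] L, (n' : ℤ) • Rσ σ ∈ ((W.baseChange F).baseChange L).goodReductionSubgroup R)
    (hU : ∀ σ : L ≃ₐ[F] L, σ • U - U = Rσ σ)
    (hpU : ((p ^ m : ℕ) : ℤ) • U =
      P - Affine.Point.baseChange (W' := (W.baseChange F).toAffine) F L t) :
    W.localKummerMap F hn t ∈ connectedKummerCondition W F R₀ hn :=
  localKummerMap_mem_connectedKummerCondition_of_cocycle_baseChange W F L R₀ R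
    (fun σ _ hQ ↦ smul_mem_goodReductionSubgroup (W.baseChange F) L R hR σ hQ)
    (hα_of_not_hasGoodReduction_of_adicComplete (W.baseChange F) L R W₀ hX hbad hR φ hφ hφn hcard
      hfrob hϖ hπ)
    hcop hn hP hR' hU hpU

/-- **The same with the badness read on `E` over `K_v`** (`hbad₀ : ¬ ((W ⊗ F) ⊗ F).HasGoodReduction
R₀`, the base minimal equation has bad reduction — e.g. `v ∣ N`): bad reduction ascends to the
layer (§0), so §1 applies. [cite: Jetchev2008, Prop. 4.1 (pp. 819–821)] -/
theorem localKummerMap_mem_connectedKummerCondition_of_cocycle_of_not_hasGoodReduction_base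
    [IsGalois F L] [IsLocalHom (algebraMap R₀ R)] [(W.baseChange F).IsMinimal R₀]
    [((W.baseChange F).baseChange F).IsMinimal R₀] [((W.baseChange F).baseChange L).IsMinimal R]
    (hbad₀ : ¬ ((W.baseChange F).baseChange F).HasGoodReduction R₀)
    (hX : (W.baseChange F).baseChange L = W₀.baseChange L)
    (hR : ∀ (τ : L ≃ₐ[F] L) (x : L), x ∈ Set.range (algebraMap R L) →
      τ x ∈ Set.range (algebraMap R L))
    (φ : L ≃ₐ[F] L) (hφ : ∀ σ : L ≃ₐ[F] L, σ ∈ Subgroup.zpowers φ) {q n : ℕ} (hφn : φ ^ n = 1)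
    (hcard : Nat.card (IsLocalRing.ResidueField R) = q ^ n)
    (hfrob : ∀ a : R, ∃ a' : R, algebraMap R L a' = φ (algebraMap R L a) ∧
      IsLocalRing.residue R a' = IsLocalRing.residue R a ^ q)
    {ϖ : R} (hϖ : Irreducible ϖ) {π : F} (hπ : algebraMap F L π = algebraMap R L ϖ)
    {p m n' : ℕ} (hcop : Nat.Coprime n' (p ^ m)) (hn : ((p ^ m : ℕ) : ℤ) ≠ 0)
    {t : (W.baseChange F).toAffine.Point} {U P : ((W.baseChange F).baseChange L).toAffine.Point}
    {Rσ : (L ≃ₐ[F] L) → ((W.baseChange F).baseChange L).toAffine.Point}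
    (hP : (n' : ℤ) • P ∈ ((W.baseChange F).baseChange L).goodReductionSubgroup R)
    (hR' : ∀ σ : L ≃ₐ[F] L, (n' : ℤ) • Rσ σ ∈ ((W.baseChange F).baseChange L).goodReductionSubgroup R)
    (hU : ∀ σ : L ≃ₐ[F] L, σ • U - U = Rσ σ)
    (hpU : ((p ^ m : ℕ) : ℤ) • U =
      P - Affine.Point.baseChange (W' := (W.baseChange F).toAffine) F L t) :
    W.localKummerMap F hn t ∈ connectedKummerCondition W F R₀ hn :=
  localKummerMap_mem_connectedKummerCondition_of_cocycle_of_not_hasGoodReduction W F L R₀ R W₀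
    (not_hasGoodReduction_baseChange_of_not_hasGoodReduction (W.baseChange F) L R₀ R hbad₀) hX hR φ
    hφ hφn hcard hfrob hϖ hπ hcop hn hP hR' hU hpU

end Global

/-! ### §2 `E/ℚ` at any bad prime -/

section Padic

variable (W : WeierstrassCurve ℚ) [W.IsElliptic] [W.IsGloballyMinimal] (p : ℕ) [Fact p.Prime]
  (L : Type) [Field L] [Algebra ℚ_[p] L]
  (R : Type*) [CommRing R] [IsDomain R] [IsDiscreteValuationRing R] [Algebra R L]
  [IsFractionRing R L] [Algebra ℤ_[p] R] [Algebra ℤ_[p] L] [IsScalarTower ℤ_[p] R L]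
  [IsScalarTower ℤ_[p] ℚ_[p] L] [IsLocalHom (algebraMap ℤ_[p] R)]
  [IsAdicComplete (IsLocalRing.maximalIdeal R) R] [Finite (IsLocalRing.ResidueField R)]

/-- **Jetchev's Prop. 4.1 at `v ∣ p` for `E/ℚ` at ANY BAD prime `p`, restricted-global Kummer
currency, ONE call** (`hg : ¬ W.HasGoodReductionAtPrime p`: split or non-split multiplicative, or
additive): `W.localKummerMap ℚ_[p] hn t ∈ connectedKummerCondition W ℚ_[p] ℤ_[p] hn` modulo (b)
and the cocycle over the layer `L` only; (α) = part 15
`hα_padic_of_not_hasGoodReductionAtPrime_of_adicComplete`. The layer binder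
`[((W ⊗ ℚ_p) ⊗ L).IsMinimal R]` is a theorem from the other binders
(`haveI := isMinimal_baseChange_padic_of_frobenius W p L R hR φ hφ hφn hcard hfrob hϖ hπ`,
part 19). With `JetchevKummerLink` §4, on pairs with `p ∤ c_p` the condition is the full local
condition. `JET@p|N` NOT discharged. [cite: Jetchev2008, Prop. 4.1 (pp. 819–821), Lemma 3.2]
[cite: MilneADT2006, Ch. I Prop. 3.8] -/
theorem localKummerMap_mem_connectedKummerCondition_padic_of_cocycle_of_not_hasGoodReductionAtPrime
    [IsGalois ℚ_[p] L] [((W.baseChange ℚ_[p]).baseChange L).IsMinimal R]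
    (hg : ¬ W.HasGoodReductionAtPrime p) (W₀ : WeierstrassCurve R)
    (hX : (W.baseChange ℚ_[p]).baseChange L = W₀.baseChange L)
    (hR : ∀ (τ : L ≃ₐ[ℚ_[p]] L) (x : L), x ∈ Set.range (algebraMap R L) →
      τ x ∈ Set.range (algebraMap R L))
    (φ : L ≃ₐ[ℚ_[p]] L) (hφ : ∀ σ : L ≃ₐ[ℚ_[p]] L, σ ∈ Subgroup.zpowers φ) {q n : ℕ}
    (hφn : φ ^ n = 1) (hcard : Nat.card (IsLocalRing.ResidueField R) = q ^ n)
    (hfrob : ∀ a : R, ∃ a' : R, algebraMap R L a' = φ (algebraMap R L a) ∧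
      IsLocalRing.residue R a' = IsLocalRing.residue R a ^ q)
    {ϖ : R} (hϖ : Irreducible ϖ) {π : ℚ_[p]} (hπ : algebraMap ℚ_[p] L π = algebraMap R L ϖ)
    {m n' : ℕ} (hcop : Nat.Coprime n' (p ^ m)) (hn : ((p ^ m : ℕ) : ℤ) ≠ 0)
    {t : (W.baseChange ℚ_[p]).toAffine.Point}
    {U P : ((W.baseChange ℚ_[p]).baseChange L).toAffine.Point}
    {Rσ : (L ≃ₐ[ℚ_[p]] L) → ((W.baseChange ℚ_[p]).baseChange L).toAffine.Point}
    (hP : (n' : ℤ) • P ∈ ((W.baseChange ℚ_[p]).baseChange L).goodReductionSubgroup R)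
    (hR' : ∀ σ : L ≃ₐ[ℚ_[p]] L,
      (n' : ℤ) • Rσ σ ∈ ((W.baseChange ℚ_[p]).baseChange L).goodReductionSubgroup R)
    (hU : ∀ σ : L ≃ₐ[ℚ_[p]] L, σ • U - U = Rσ σ)
    (hpU : ((p ^ m : ℕ) : ℤ) • U =
      P - Affine.Point.baseChange (W' := (W.baseChange ℚ_[p]).toAffine) ℚ_[p] L t) :
    W.localKummerMap ℚ_[p] hn t ∈ connectedKummerCondition W ℚ_[p] ℤ_[p] hn :=
  localKummerMap_mem_connectedKummerCondition_of_cocycle_baseChange W ℚ_[p] L ℤ_[p] R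
    (fun σ _ hQ ↦ smul_mem_goodReductionSubgroup (W.baseChange ℚ_[p]) L R hR σ hQ)
    (hα_padic_of_not_hasGoodReductionAtPrime_of_adicComplete W p L R hg W₀ hX hR φ hφ hφn hcard
      hfrob hϖ hπ)
    hcop hn hP hR' hU hpU

end Padic

end Summit.BirchSwinnertonDyer.Rank1Residual.X11b.Three.JetchevKummer

end
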